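import Summits.SmoothPoincare4.SmoothPoincare4.Theorems.SblfDescentRungOneHelperDxTorus
import Summits.SmoothPoincare4.SmoothPoincare4.Theorems.SblfDescentRungOneHelperDxCircle
import Summits.SmoothPoincare4.SmoothPoincare4.Theorems.SblfDescentRungOneHelperDxAngle
import HarnessLib

/-!
# Disc extension, layer 7: transferring the glued angular map to the total space

Auxiliary file of helper `helper_sliceGluing_discExtension` (apex leaf DX: extension of the
torus angular coordinate over the torus disc), line `Sketch`, crux `SblfDescent.RungOne`.

(Crux item stmt-SmoothPoincare4-18531; skeleton `Cruxes/RungOne/Lines/Sketch.lean`.)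

Given the torus side `ιT : Fb × ℝ² ↪ X`, a rigid collar `(ιC, aC, bC)` on the band, the fold
tube `ν` (with `ε₂ ≤ ε`), and a `Circle`-valued map `Acirc` on `Fb × {‖w‖ < a + d}` which is
smooth, fibrewise of non-zero rank, and equal to `toCircle ∘ aC ∘ ιT` on the shell
`a ≤ ‖w‖ < a + d` (the output of layer 6), we define the angular map on `X`,

  `Aext x = ofCircle (Acirc (ιT⁻¹ x))` if `x = ιT (θ, w)` with `‖w‖ < a + d`, and `aC x` otherwise,

and verify the fields of `IsTorusAngular` with `sA = 1/(1 + 2(a + d)²)`, `sB = 1/(1 + 2a²)`: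
smoothness on `{sA < h}` (`contMDiffOn_Aext`), fibrewise submersivity (`submersive_Aext`: the
vertical vector `dιT (ξ, 0)` is killed by `df` since `f ∘ ιT` factors through the base, and not
by `dAext`), and rigidity on the tube part of the shell (`rigid_Aext`, from `IsRigidCollar.rigid`
since `Aext = aC` there and the height along the tube is `Q = x₀² + x₁² - x₂²`).
Everything is folklore differential topology.
-/

set_option linter.dupNamespace false

noncomputable section

open scoped Manifold ContDiff Topology Real
open Set Function Metric Literature.Topology.FourManifolds

namespace Summit.SmoothPoincare4.SmoothPoincare4.Cruxes.RungOne.Sketch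

namespace DiscExt

/-- Local notation: `𝔼 n` is the model Euclidean space `EuclideanSpace ℝ (Fin n)`. -/
local notation "𝔼 " n:arg => EuclideanSpace ℝ (Fin n)

/-- Local notation: `𝕊¹`, the unit circle of `ℝ²`. -/
local notation "𝕊¹" => (Metric.sphere (0 : EuclideanSpace ℝ (Fin 2)) (1 : ℝ))

/-- Local notation: `𝕊²`, the unit sphere of `ℝ³`. -/
local notation "𝕊²" => (Metric.sphere (0 : EuclideanSpace ℝ (Fin 3)) (1 : ℝ))

attribute [local instance] Literature.Topology.FourManifolds.fact_finrank_euclideanSpace_succ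

/-- The height `x ↦ v₂ (f x)₂` is continuous. [folklore] -/
theorem continuous_hgt {X : Type} [TopologicalSpace X] {f : X → 𝕊²} {v : 𝕊²} (hf : Continuous f) :
    Continuous fun x : X ↦ (v : 𝔼 3) 2 * ((f x : 𝕊²) : 𝔼 3) 2 := by
  have h1 : Continuous fun x : X ↦ ((f x : 𝕊²) : 𝔼 3) := continuous_subtype_val.comp hf
  exact continuous_const.mul ((EuclideanSpace.proj (𝕜 := ℝ) (2 : Fin 3)).continuous.comp h1)

section Setup

variable {X : Type} [TopologicalSpace X] [ChartedSpace (𝔼 4) X]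
  {Fb : Type} [TopologicalSpace Fb] [ChartedSpace (𝔼 2) Fb]
  {f : X → 𝕊²} {v : 𝕊²} {ιT : Fb × 𝔼 2 → X}
  {ν : 𝕊¹ × 𝔼 3 → X} {σ ε : ℝ} {g : ℝ → ℝ} {s₁ s₂ ε₂ : ℝ}
  {ιC : (𝕊¹ × 𝕊¹) × (𝕊¹ × ℝ) → X} {aC bC : X → 𝕊¹}
  {Acirc : Fb × 𝔼 2 → Circle} {a d : ℝ}

/-! ### The level sets of the height in the product coordinates -/

/-- `sA = 1/(1 + 2ρ²)` is the height at radius `ρ ≥ 0`: `sA < h (ιT (θ, w)) ↔ ‖w‖ < ρ`. [folklore] -/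
theorem level_lt_hgt_ιT_iff (hT : IsTorusSideProduct f v ιT) (hv0 : (v : 𝔼 3) 0 = 0) (hv1 : (v : 𝔼 3) 1 = 0)
    {ρ : ℝ} (hρ : 0 ≤ ρ) (θ : Fb) (w : 𝔼 2) :
    (1 + 2 * ρ ^ 2)⁻¹ < hgt f v (ιT (θ, w)) ↔ ‖w‖ < ρ := by
  rw [hgt_ιT hT hv0 hv1, ← sT_smul_circlePt ρ 0, sT_lt_sT_iff, norm_smul_circlePt hρ]

/-- `h (ιT (θ, w)) < 1/(1 + 2ρ²) ↔ ρ < ‖w‖`. [folklore] -/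
theorem hgt_ιT_lt_level_iff (hT : IsTorusSideProduct f v ιT) (hv0 : (v : 𝔼 3) 0 = 0) (hv1 : (v : 𝔼 3) 1 = 0)
    {ρ : ℝ} (hρ : 0 ≤ ρ) (θ : Fb) (w : 𝔼 2) :
    hgt f v (ιT (θ, w)) < (1 + 2 * ρ ^ 2)⁻¹ ↔ ρ < ‖w‖ := by
  rw [hgt_ιT hT hv0 hv1, ← sT_smul_circlePt ρ 0, sT_lt_sT_iff, norm_smul_circlePt hρ]

/-- **Points of height `> sA` are `ιT (θ, w)` with `‖w‖ < a + d`.** [folklore] -/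
theorem exists_eq_ιT_of_lt_hgt (hT : IsTorusSideProduct f v ιT) (hv0 : (v : 𝔼 3) 0 = 0)
    (hv1 : (v : 𝔼 3) 1 = 0) {ρ : ℝ} (hρ : 0 ≤ ρ) {x : X} (hx : (1 + 2 * ρ ^ 2)⁻¹ < hgt f v x) :
    ∃ (θ : Fb) (w : 𝔼 2), ‖w‖ < ρ ∧ ιT (θ, w) = x := by
  have hpos : 0 < hgt f v x := lt_trans (by positivity) hx
  obtain ⟨⟨θ, w⟩, rfl⟩ := (mem_range_ιT_iff hT hv0 hv1).2 hpos
  exact ⟨θ, w, (level_lt_hgt_ιT_iff hT hv0 hv1 hρ θ w).1 hx, rfl⟩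

/-- **Vertical vectors**: `df` kills `dιT (ξ, 0)`, because `f ∘ ιT` factors through the base.
[folklore] -/
theorem mfderiv_f_ιT_vertical (hT : IsTorusSideProduct f v ιT) (hf : ContMDiff (𝓡 4) (𝓡 2) ∞ f)
    (θ : Fb) (w : 𝔼 2) (ξ : 𝔼 2) :
    mfderiv (𝓡 4) (𝓡 2) f (ιT (θ, w))
      (mfderiv ((𝓡 2).prod (𝓡 2)) (𝓡 4) ιT (θ, w) ((ξ, 0) : 𝔼 2 × 𝔼 2)) = 0 := by
  have hιd : MDifferentiableAt ((𝓡 2).prod (𝓡 2)) (𝓡 4) ιT (θ, w) :=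
    (hT.isSmoothEmbedding.contMDiff (θ, w)).mdifferentiableAt (by simp)
  have hfd : MDifferentiableAt (𝓡 4) (𝓡 2) f (ιT (θ, w)) := (hf _).mdifferentiableAt (by simp)
  have hchain := mfderiv_comp (θ, w) hfd hιd
  have hfac : f ∘ ιT = yT v ∘ Prod.snd := funext fun p ↦ hT.formula p
  have hyd : MDifferentiableAt (𝓡 2) (𝓡 2) (yT v) w := ((contMDiff_yT v) w).mdifferentiableAt (by simp)
  have hchain2 : mfderiv ((𝓡 2).prod (𝓡 2)) (𝓡 2) (yT v ∘ Prod.snd) (θ, w) =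
      (mfderiv (𝓡 2) (𝓡 2) (yT v) w).comp
        (mfderiv ((𝓡 2).prod (𝓡 2)) (𝓡 2) (Prod.snd : Fb × 𝔼 2 → 𝔼 2) (θ, w)) :=
    mfderiv_comp (θ, w) hyd mdifferentiableAt_snd
  rw [hfac, hchain2, mfderiv_snd] at hchain
  have key : mfderiv (𝓡 4) (𝓡 2) f (ιT (θ, w))
      (mfderiv ((𝓡 2).prod (𝓡 2)) (𝓡 4) ιT (θ, w) ((ξ, 0) : 𝔼 2 × 𝔼 2)) =
      mfderiv (𝓡 2) (𝓡 2) (yT v) w (0 : TangentSpace (𝓡 2) w) :=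
    (DFunLike.congr_fun hchain ((ξ, 0) : 𝔼 2 × 𝔼 2)).symm
  exact key.trans (map_zero _)

/-! ### Along the fold tube -/

/-- **The height along the fold tube is `Q = x₀² + x₁² - x₂²`.** [folklore] -/
theorem hgt_ν (hF : IsFoldTube f v ε ν) (hv0 : (v : 𝔼 3) 0 = 0) (hv1 : (v : 𝔼 3) 1 = 0) (u : 𝕊¹)
    {x : 𝔼 3} (hx : x ∈ ball (0 : 𝔼 3) ε) : hgt f v (ν (u, x)) = x 0 ^ 2 + x 1 ^ 2 - x 2 ^ 2 := by
  rw [hgt, (hF.formula u x hx).2.2, ← mul_assoc, pole_mul_self hv0 hv1, one_mul]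

/-- **A tube point of height in `(sA, sB)` is `ιT (θ, w)` with `a < ‖w‖ < a + d`**, where
`sA = 1/(1 + 2(a + d)²)`, `sB = 1/(1 + 2a²)`. [folklore] -/
theorem exists_eq_ιT_of_mem_shell (hT : IsTorusSideProduct f v ιT) (hv0 : (v : 𝔼 3) 0 = 0)
    (hv1 : (v : 𝔼 3) 1 = 0) (ha : 0 ≤ a) (had : 0 ≤ a + d) {x : X}
    (h1 : (1 + 2 * (a + d) ^ 2)⁻¹ < hgt f v x) (h2 : hgt f v x < (1 + 2 * a ^ 2)⁻¹) :
    ∃ (θ : Fb) (w : 𝔼 2), a < ‖w‖ ∧ ‖w‖ < a + d ∧ ιT (θ, w) = x := by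
  obtain ⟨θ, w, hw, rfl⟩ := exists_eq_ιT_of_lt_hgt hT hv0 hv1 had h1
  exact ⟨θ, w, (hgt_ιT_lt_level_iff hT hv0 hv1 ha θ w).1 h2, hw, rfl⟩

variable [Nonempty Fb]

/-! ### The angular map on the total space -/

variable (ιT aC Acirc a d) in
open Classical in
/-- **The angular map on the total space** (see the module docstring). [folklore] -/
def Aext (x : X) : 𝕊¹ :=
  if x ∈ range ιT ∧ ‖(invFun ιT x).2‖ < a + d then ofCircle (Acirc (invFun ιT x)) else aC x

/-- `ιT⁻¹ (ιT p) = p`. [folklore] -/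
theorem invFun_ιT_apply (hT : IsTorusSideProduct f v ιT) (p : Fb × 𝔼 2) : invFun ιT (ιT p) = p :=
  Function.leftInverse_invFun (ιT_injective hT) p

/-- `Aext` on the disc `‖w‖ < a + d`. [folklore] -/
theorem Aext_ιT_of_lt (hT : IsTorusSideProduct f v ιT) {θ : Fb} {w : 𝔼 2} (hw : ‖w‖ < a + d) :
    Aext ιT aC Acirc a d (ιT (θ, w)) = ofCircle (Acirc (θ, w)) := by
  rw [Aext, if_pos ⟨mem_range_self _, by rwa [invFun_ιT_apply hT]⟩, invFun_ιT_apply hT]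

/-- `Aext = aC` on the shell `a ≤ ‖w‖` (where `Acirc` is `toCircle ∘ aC ∘ ιT`). [folklore] -/
theorem Aext_ιT_of_ge (hT : IsTorusSideProduct f v ιT)
    (hAeq : ∀ (θ : Fb) (w : 𝔼 2), a ≤ ‖w‖ → ‖w‖ < a + d → Acirc (θ, w) = toCircle (aC (ιT (θ, w))))
    {θ : Fb} {w : 𝔼 2} (hw : a ≤ ‖w‖) : Aext ιT aC Acirc a d (ιT (θ, w)) = aC (ιT (θ, w)) := by
  by_cases hlt : ‖w‖ < a + d
  · rw [Aext_ιT_of_lt hT hlt, hAeq θ w hw hlt, ofCircle_toCircle]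
  · rw [Aext, if_neg]
    rw [invFun_ιT_apply hT]
    exact fun h ↦ hlt h.2

/-! ### Smoothness -/

/-- **`Aext` is smooth on `{sA < h}`**, `sA = 1/(1 + 2(a + d)²)`. [folklore] -/
theorem contMDiffOn_Aext (hT : IsTorusSideProduct f v ιT) (hv0 : (v : 𝔼 3) 0 = 0) (hv1 : (v : 𝔼 3) 1 = 0)
    (had : 0 ≤ a + d)
    (hAs : ContMDiffOn ((𝓡 2).prod (𝓡 2)) (𝓡 1) ∞ Acirc (univ ×ˢ ball (0 : 𝔼 2) (a + d))) :
    ContMDiffOn (𝓡 4) (𝓡 1) ∞ (Aext ιT aC Acirc a d)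
      {x | (1 + 2 * (a + d) ^ 2)⁻¹ < (v : 𝔼 3) 2 * ((f x : 𝕊²) : 𝔼 3) 2} := by
  haveI : Nonempty (Fb × 𝔼 2) := inferInstance
  have hsub : {x | (1 + 2 * (a + d) ^ 2)⁻¹ < (v : 𝔼 3) 2 * ((f x : 𝕊²) : 𝔼 3) 2} ⊆ range ιT := by
    intro x hx
    obtain ⟨θ, w, -, rfl⟩ := exists_eq_ιT_of_lt_hgt hT hv0 hv1 had hx
    exact mem_range_self _
  have hinv : ContMDiffOn (𝓡 4) ((𝓡 2).prod (𝓡 2)) ∞ (invFun ιT)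
      {x | (1 + 2 * (a + d) ^ 2)⁻¹ < (v : 𝔼 3) 2 * ((f x : 𝕊²) : 𝔼 3) 2} :=
    (Literature.Geometry.Manifold.contMDiffOn_invFun_range hT.isSmoothEmbedding).mono hsub
  have hmaps : MapsTo (invFun ιT) {x | (1 + 2 * (a + d) ^ 2)⁻¹ < (v : 𝔼 3) 2 * ((f x : 𝕊²) : 𝔼 3) 2}
      (univ ×ˢ ball (0 : 𝔼 2) (a + d)) := by
    intro x hx
    obtain ⟨θ, w, hw, rfl⟩ := exists_eq_ιT_of_lt_hgt hT hv0 hv1 had hx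
    rw [invFun_ιT_apply hT]
    exact ⟨mem_univ _, mem_ball_zero_iff.2 hw⟩
  have hcomp := contMDiff_ofCircle.comp_contMDiffOn (hAs.comp hinv hmaps)
  refine hcomp.congr fun x hx ↦ ?_
  obtain ⟨θ, w, hw, rfl⟩ := exists_eq_ιT_of_lt_hgt hT hv0 hv1 had hx
  rw [Aext_ιT_of_lt hT hw, comp_apply, comp_apply, invFun_ιT_apply hT]

/-! ### Fibrewise submersivity -/

/-- **`Aext` is fibrewise submersive on `{sA < h}`.** [folklore] -/
theorem submersive_Aext [IsManifold (𝓡 2) ∞ Fb] (hT : IsTorusSideProduct f v ιT)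
    (hv0 : (v : 𝔼 3) 0 = 0) (hv1 : (v : 𝔼 3) 1 = 0) (hf : ContMDiff (𝓡 4) (𝓡 2) ∞ f) (had : 0 ≤ a + d)
    (hAs : ContMDiffOn ((𝓡 2).prod (𝓡 2)) (𝓡 1) ∞ Acirc (univ ×ˢ ball (0 : 𝔼 2) (a + d)))
    (hAd : ∀ w : 𝔼 2, ‖w‖ < a + d → ∀ θ : Fb, mfderiv (𝓡 2) (𝓡 1) (fun θ' ↦ Acirc (θ', w)) θ ≠ 0)
    (x : X) (hx : (1 + 2 * (a + d) ^ 2)⁻¹ < (v : 𝔼 3) 2 * ((f x : 𝕊²) : 𝔼 3) 2) :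
    ∃ y : 𝔼 4, mfderiv (𝓡 4) (𝓡 2) f x y = 0 ∧ mfderiv (𝓡 4) (𝓡 1) (Aext ιT aC Acirc a d) x y ≠ 0 := by
  haveI : Nonempty (Fb × 𝔼 2) := inferInstance
  obtain ⟨θ, w, hw, rfl⟩ := exists_eq_ιT_of_lt_hgt hT hv0 hv1 had hx
  -- a fibre direction on which the slice of `Acirc` has non-zero derivative
  obtain ⟨ξ, hξ⟩ : ∃ ξ : 𝔼 2, mfderiv (𝓡 2) (𝓡 1) (fun θ' ↦ Acirc (θ', w)) θ ξ ≠ 0 := by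
    by_contra h
    push Not at h
    exact hAd w hw θ (ContinuousLinearMap.ext h)
  refine ⟨mfderiv ((𝓡 2).prod (𝓡 2)) (𝓡 4) ιT (θ, w) ((ξ, 0) : 𝔼 2 × 𝔼 2),
    mfderiv_f_ιT_vertical hT hf θ w ξ, ?_⟩
  -- differentiability data
  have hopen : IsOpen ((univ : Set Fb) ×ˢ ball (0 : 𝔼 2) (a + d)) := isOpen_univ.prod isOpen_ball
  have hmem : (θ, w) ∈ (univ : Set Fb) ×ˢ ball (0 : 𝔼 2) (a + d) := ⟨mem_univ _, mem_ball_zero_iff.2 hw⟩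
  have hAat : ContMDiffAt ((𝓡 2).prod (𝓡 2)) (𝓡 1) ∞ Acirc (θ, w) := hAs.contMDiffAt (hopen.mem_nhds hmem)
  have hAd' : MDifferentiableAt ((𝓡 2).prod (𝓡 2)) (𝓡 1) Acirc (θ, w) := hAat.mdifferentiableAt (by simp)
  have hιd : MDifferentiableAt ((𝓡 2).prod (𝓡 2)) (𝓡 4) ιT (θ, w) :=
    (hT.isSmoothEmbedding.contMDiff (θ, w)).mdifferentiableAt (by simp)
  have hUopen : IsOpen {x : X | (1 + 2 * (a + d) ^ 2)⁻¹ < (v : 𝔼 3) 2 * ((f x : 𝕊²) : 𝔼 3) 2} :=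
    isOpen_lt continuous_const (continuous_hgt hf.continuous)
  have hAext : ContMDiffAt (𝓡 4) (𝓡 1) ∞ (Aext ιT aC Acirc a d) (ιT (θ, w)) :=
    (contMDiffOn_Aext hT hv0 hv1 had hAs).contMDiffAt (hUopen.mem_nhds hx)
  have hAextd : MDifferentiableAt (𝓡 4) (𝓡 1) (Aext ιT aC Acirc a d) (ιT (θ, w)) :=
    hAext.mdifferentiableAt (by simp)
  -- `Aext ∘ ιT = ofCircle ∘ Acirc` near `(θ, w)`
  have hev : (Aext ιT aC Acirc a d ∘ ιT) =ᶠ[𝓝 (θ, w)] (ofCircle ∘ Acirc) := by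
    filter_upwards [hopen.mem_nhds hmem] with p hp
    rw [comp_apply, comp_apply, show p = (p.1, p.2) from rfl, Aext_ιT_of_lt hT (mem_ball_zero_iff.1 hp.2)]
  have hchain1 : mfderiv ((𝓡 2).prod (𝓡 2)) (𝓡 1) (Aext ιT aC Acirc a d ∘ ιT) (θ, w) =
      (mfderiv (𝓡 4) (𝓡 1) (Aext ιT aC Acirc a d) (ιT (θ, w))).comp
        (mfderiv ((𝓡 2).prod (𝓡 2)) (𝓡 4) ιT (θ, w)) := mfderiv_comp (θ, w) hAextd hιd
  have hofd : MDifferentiableAt (𝓡 1) (𝓡 1) ofCircle (Acirc (θ, w)) :=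
    (contMDiff_ofCircle _).mdifferentiableAt (by simp)
  have hchain2 : mfderiv ((𝓡 2).prod (𝓡 2)) (𝓡 1) (ofCircle ∘ Acirc) (θ, w) =
      (mfderiv (𝓡 1) (𝓡 1) ofCircle (Acirc (θ, w))).comp (mfderiv ((𝓡 2).prod (𝓡 2)) (𝓡 1) Acirc (θ, w)) :=
    mfderiv_comp (θ, w) hofd hAd'
  have heq : mfderiv ((𝓡 2).prod (𝓡 2)) (𝓡 1) (Aext ιT aC Acirc a d ∘ ιT) (θ, w) =
      mfderiv ((𝓡 2).prod (𝓡 2)) (𝓡 1) (ofCircle ∘ Acirc) (θ, w) := hev.mfderiv_eq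
  rw [hchain1, hchain2] at heq
  have key : mfderiv (𝓡 4) (𝓡 1) (Aext ιT aC Acirc a d) (ιT (θ, w))
      (mfderiv ((𝓡 2).prod (𝓡 2)) (𝓡 4) ιT (θ, w) ((ξ, 0) : 𝔼 2 × 𝔼 2)) =
      mfderiv (𝓡 1) (𝓡 1) ofCircle (Acirc (θ, w))
        (mfderiv ((𝓡 2).prod (𝓡 2)) (𝓡 1) Acirc (θ, w) ((ξ, 0) : 𝔼 2 × 𝔼 2)) :=
    DFunLike.congr_fun heq ((ξ, 0) : 𝔼 2 × 𝔼 2)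
  rw [key]
  -- the slice derivative
  have hslice : mfderiv ((𝓡 2).prod (𝓡 2)) (𝓡 1) Acirc (θ, w) ((ξ, 0) : 𝔼 2 × 𝔼 2) =
      mfderiv (𝓡 2) (𝓡 1) (fun θ' ↦ Acirc (θ', w)) θ ξ := by
    have hc : (fun θ' ↦ Acirc (θ', w)) = Acirc ∘ fun θ' ↦ (θ', w) := rfl
    have hsl : MDifferentiableAt (𝓡 2) ((𝓡 2).prod (𝓡 2)) (fun θ' : Fb ↦ ((θ', w) : Fb × 𝔼 2)) θ :=
      mdifferentiableAt_id.prodMk mdifferentiableAt_const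
    rw [hc, mfderiv_comp θ hAd' hsl, mfderiv_prod_left]
    rfl
  rw [hslice]
  -- `ofCircle` has injective differential
  have hinj : Injective (mfderiv (𝓡 1) (𝓡 1) ofCircle (Acirc (θ, w))) :=
    injective_mfderiv_of_inverse (G := toCircle) (contMDiff_ofCircle _) (contMDiff_toCircle _)
      toCircle_ofCircle
  intro h0
  apply hξ
  apply hinj
  rw [h0]
  exact (map_zero _).symm

/-! ### Rigidity on the tube part of the shell -/

/-- **`Aext = aC` on the shell `{sA < h < sB}`.** [folklore] -/
theorem Aext_eq_aC_of_mem_shell (hT : IsTorusSideProduct f v ιT) (hv0 : (v : 𝔼 3) 0 = 0)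
    (hv1 : (v : 𝔼 3) 1 = 0) (ha : 0 ≤ a) (had : 0 ≤ a + d)
    (hAeq : ∀ (θ : Fb) (w : 𝔼 2), a ≤ ‖w‖ → ‖w‖ < a + d → Acirc (θ, w) = toCircle (aC (ιT (θ, w))))
    {x : X} (h1 : (1 + 2 * (a + d) ^ 2)⁻¹ < hgt f v x) (h2 : hgt f v x < (1 + 2 * a ^ 2)⁻¹) :
    Aext ιT aC Acirc a d x = aC x := by
  obtain ⟨θ, w, hw1, -, rfl⟩ := exists_eq_ιT_of_mem_shell hT hv0 hv1 ha had h1 h2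
  exact Aext_ιT_of_ge hT hAeq hw1.le

/-- **`Aext` is rigid on the tube part of the shell**: `Aext (ν (u, x)) = rigidDir σ (g x₂) u` for
`x ∈ B(0, ε₂)` with `sA < Q x < sB`. [folklore] -/
theorem rigid_Aext (hT : IsTorusSideProduct f v ιT) (hC : IsRigidCollar f v ν σ g s₁ s₂ ε₂ ιC aC bC)
    (hF : IsFoldTube f v ε ν) (hε : ε₂ ≤ ε) (hv0 : (v : 𝔼 3) 0 = 0) (hv1 : (v : 𝔼 3) 1 = 0)
    (ha : 0 ≤ a) (had : 0 ≤ a + d) (hs₁ : s₁ ≤ (1 + 2 * (a + d) ^ 2)⁻¹) (hs₂ : (1 + 2 * a ^ 2)⁻¹ ≤ s₂)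
    (hAeq : ∀ (θ : Fb) (w : 𝔼 2), a ≤ ‖w‖ → ‖w‖ < a + d → Acirc (θ, w) = toCircle (aC (ιT (θ, w))))
    (u : 𝕊¹) (x : 𝔼 3) (hx : x ∈ ball (0 : 𝔼 3) ε₂)
    (h1 : (1 + 2 * (a + d) ^ 2)⁻¹ < x 0 ^ 2 + x 1 ^ 2 - x 2 ^ 2)
    (h2 : x 0 ^ 2 + x 1 ^ 2 - x 2 ^ 2 < (1 + 2 * a ^ 2)⁻¹) :
    ((Aext ιT aC Acirc a d (ν (u, x)) : 𝕊¹) : 𝔼 2) = rigidDir σ (g (x 2)) u := by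
  have hx' : x ∈ ball (0 : 𝔼 3) ε := ball_subset_ball hε hx
  have hh := hgt_ν hF hv0 hv1 u hx'
  rw [Aext_eq_aC_of_mem_shell hT hv0 hv1 ha had hAeq (by rw [hh]; exact h1) (by rw [hh]; exact h2)]
  exact hC.rigid u x hx (lt_of_le_of_lt hs₁ h1) (lt_of_lt_of_le h2 hs₂)

end Setup

end DiscExt

end Summit.SmoothPoincare4.SmoothPoincare4.Cruxes.RungOne.Sketch

end
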